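import Mathlib
import Literature.MathematicalPhysics.QuantumFieldTheory.Balaban1983to89.B5AverageCurlStokes
import Literature.MathematicalPhysics.QuantumFieldTheory.Balaban1983to89.B5Bounds167Lattice
import Literature.MathematicalPhysics.QuantumFieldTheory.Balaban1983to89.Beta.BlockEffectiveAction

/-!
# The lower half of (1.67), `⟨∂₁B, ∂₁B⟩ ≤ ⟨B, Δ_kB⟩`, for the GENUINE `k`-step effective action operator `Δ_k`

HONEST SCOPE (page 1 of everything in this cell): discharging `BetaPertH` makes Bałaban's UV stability
UNCONDITIONAL — a real constructive-QFT result; it is NOT the continuum limit and NOT the Clay problem.  This file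
is KERNEL BOOKKEEPING for one half of one printed inequality about a finite matrix; it claims nothing about `β`,
nothing about the far regions, and nothing about the summit.

PRINTED TEXT (T. Bałaban, *Propagators and renormalization transformations for lattice gauge theories. I*,
Commun. Math. Phys. **95** (1984) 17–40 = [Balaban1984PropagatorsI], p. 29 [PDF 13], render
`b2b-balaban-ref1/pages/1984-cmp95-propagators-rt-I/…-p013-x2.png` read as an image by the author of this file;
TEXT LOCATIONS ONLY — nothing printed enters as a hypothesis, ABSOLUTE RULE):
* (1.65) «⟨B, Δ_kB⟩ = ⟨∂H_kB, ∂H_kB⟩» — the `k`-step effective action as the curl energy of the minimizer `H_kB`;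
* (1.67) «γ₀⟨∂₁B, ∂₁B⟩ ≦ ⟨B, Δ_kB⟩ ≦ γ₁⟨∂₁B, ∂₁B⟩, γ₀, γ₁ > 0 depending on d only.»

THE OBJECTS (all typed upstream, nothing new is defined here except a `B5.FormData` packaging):
* `Δ_k = Beta.BlockEffectiveAction.DelK n hn M a ha := n^{-d}·H_kᴴ(½(CurlOp)ᴴCurlOp)H_k` — (1.65) for the typed
  minimizer `H_k = Beta.FluctuationProjection.Hk` ((1.103) `G Q*(QGQ*)⁻¹`, `Q_kH_k = 1` = `QvOp_mul_Hk`), on the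
  fine torus `Tor (fine n M)` (`η = 1/n`, block side `n = L^k ≥ 1`) over the unit torus `Tor M`; it is `a`-free
  (`DelK_indep`) and `(Q_kG_kQ_k*)⁻¹ = a + Δ_k` (`QGQ_inv_eq`);
* `⟨∂₁B, ∂₁B⟩ = B5Bounds167Lattice.d1Sq M B := ½ Σ_{μ,ν} Σ_y |(∂¹_μB_ν − ∂¹_νB_μ)(y)|²` (pv15 lineage, the
  `d1Sq` of the cell's `B5.FormData` carrier behind `B5.Bounds167`).

WHAT THE TREE SAID BEFORE THIS FILE.  `B5Bounds167Lattice` proves (1.67) for the form `formDk` DEFINED by the third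
expression of (1.66) and records (NOT-claimed (1)) that the identity with (1.65) is not certified;
`Beta.BlockEffectiveAction` types (1.65) and records «(1.67) for `DelK` NOT claimed»; `B5AverageCurlStokes` (t4-lit2)
proves Federbush's stability of the averaging map [Federbush1986PhaseCellI, (0.12)]
`Σ_y|F¹(Q_kA)(y)|² ≤ n^{-d}Σ_x|F^η(A)(x)|²` and says of the (1.67)-lower reading: «needs only Q_k(H_kB) = B, which
this file does not supply».

WHAT IS PROVED HERE (zero `sorry`; every `n ≥ 1`, every torus `M`, every `d`, every `a > 0`; all [folklore]
junction algebra over the three imported modules):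
* §1 `curl_eq_Fs`, `d1Sq_eq_Fs`: pv15's `curl`/`d1Sq` ARE B5Action121's plaquette field `Fs M 1` / `½Σ‖Fs‖²`
  (definitional junction of two lineages' spellings of (1.2) at `ε = 1`).
* §2 `DelK_form_eq`/`DelK_form_re`: `Bᴴ·Δ_k·B = ½·n^{-d}·Σ_{x,μ,ν}|F^η_{μν}(H_kB)(x)|²` (a real number), from
  `curl_energy_Hk` + `form_CurlOp`.
* §2 **`ineq167_lower`: `d1Sq M B ≤ Re (Bᴴ·Δ_k·B)` — THE LOWER HALF OF (1.67) FOR THE GENUINE OPERATOR WITH THE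
  SHARP CONSTANT `γ₀ = 1`**, Fourier-free: `½Σ|F¹(B)|² = ½Σ|F¹(Q_kH_kB)|² ≤ ½n^{-d}Σ|F^η(H_kB)|² = ⟨B,Δ_kB⟩`
  (Federbush stability `sum_normSq_Fs_le_of_QvOp_eq` at `A := H_kB`, `QvOp_Hk_mulVec`).  The constant is sharp
  (equality for `n = 1`, where `Q_k = H_k = 1`).
* §3 **`QGQ_inv_form_ge_d1Sq`: `a·‖B‖² + d1Sq M B ≤ Re Bᴴ(Q_kG_kQ_k*)⁻¹B`** — the operator behind the printed
  lower bound of (1.100) p. 34 now dominates `a + ⟨∂₁·,∂₁·⟩`, uniformly in `k` and the volume.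
* §4 `formOfDelK` (the `B5.FormData` carrier whose `formΔk` is the GENUINE `Re⟨B, Δ_kB⟩`) and
  **`h2118_formOfDelK`**: for EVERY family `i ↦ (n i ≥ 1, M i, a i > 0)` the statement
  `∃ γ₀ > 0, ∀ i B, γ₀·d1Sq B ≤ formΔk B` holds (γ₀ = 1) — this is LITERALLY the conclusion of the cell's DAG edge
  `B6.h2118_of_B5` (which consumes only the LOWER half of `B5.Bounds167`), so the (2.118) input of B6 is
  available for the operator carriers WITHOUT the (1.65)↔(1.66) dictionary.  `lower167_formOfDelK` = the lower
  conjunct of `B5.Bounds167` in its literal shape.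
* §5 gauge invariance of both sides: `Fs_grad` (`F(∂λ) = 0`), `d1Sq_add_grad`, `DelK_form_add_grad`
  (`Δ_k∂₁ = 0` is upstream `DelK_mulVec_grad`): both sides of (1.67) see only `B mod ∂₁λ`.
* §6 THE DOOR FOR THE UPPER HALF (not walked through): `LapV_form_eq`, `half_sum_Fs_le_gradEnergy`
  (`½Σ|F^η(A)|² ≤ Σ_{ν,κ}‖∂^η_νA_κ‖²`, from (1.21) `form_curl_eq`), `DelK_form_le_of_QvOp_eq` and
  **`DelK_form_le_gradEnergy`: `Re⟨B,Δ_kB⟩ ≤ n^{-d}Σ_{ν,κ}‖∂^η_νA_κ‖²` for EVERY fine `A` with `Q_kA = B`**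
  (`curl_energy_min`): the upper half of (1.67) with constant `γ₁` follows from ANY right inverse of `Q_k` whose
  component-wise Dirichlet energy is `≤ γ₁·n^d·⟨∂₁B,∂₁B⟩` on transverse `B` (plus §5).

WHAT IS NOT PROVED (located precisely, for the successor): the UPPER half `⟨B,Δ_kB⟩ ≤ γ₁⟨∂₁B,∂₁B⟩` for `DelK`.
Two typed roads: (E) the competitor `A := B5Hk163Torus.HkOp·B` ((1.63), `QvOp_mul_HkOp` proved by the b05 lineage)
in `DelK_form_le_of_QvOp_eq`, followed by the identification `½n^{-d}‖F^η(H^{(1.63)}B)‖² = formDk` (Bałaban's p. 29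
derivation of (1.66)) and pv15's `ineq167`; (U) the variational comparison `Δ_a ≤ ⊕_μ A_{B_μ}`
(`Beta.VectorPropagatorDict.DeltaA_eq_covSum_sub_dP`) reducing it to scalar bond-block effective energies bounded
through `φ_μ` ((1.62), pv15's `Δ₀φ_μ ≥ (4/π²)^{d+2}`).  Also NOT claimed: `DelK`'s form `=` `formDk` (the
(1.65)↔(1.66) dictionary, cell GAPS G-b05g10-4 territory), anything at `U ≠ 1`, anything about `β`.

Citations: [Balaban1984PropagatorsI] (1.65), (1.67) p. 29; (1.100) p. 34 (context for §3); (1.21) p. 21 (via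
`B5Action121.form_curl_eq`); [Federbush1986PhaseCellI] = P. Federbush, *A phase cell approach to Yang–Mills
theory. I*, Commun. Math. Phys. **107** (1986) 319–329, 'Abelian Stability Theorem' (0.12) p. 321 (via the imported
`B5AverageCurlStokes`, whose header carries the verbatim quotation); [Balaban1984PropagatorsII] (2.118)
p. 243 (context for §4, via `B6.h2118_of_B5`'s docstring).  Everything else is [folklore] and kernel-proved.
Unit `b2b-balaban-beta-an5-g11` (DEDICATED β sub-cell row BETA-an5, gen 11), node BETA-an5-g11-INEQ167-OPERATOR;
staged byte-identically under `HOME/lean/BalabanYm4/`.  Value = one half of a printed inequality for the typed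
operator, NOT summit progress.
-/

noncomputable section

open scoped BigOperators Matrix ComplexConjugate ComplexOrder
open Finset

namespace Literature.MathematicalPhysics.QuantumFieldTheory.Balaban1983to89.Beta.Ineq167Operator

open Literature.MathematicalPhysics.QuantumFieldTheory.Balaban1983to89
open Literature.MathematicalPhysics.QuantumFieldTheory.Balaban1983to89.B5Prop11Plancherel (Tor fine unitVec fdiff)
open Literature.MathematicalPhysics.QuantumFieldTheory.Balaban1983to89.B5Prop11Lower (nsq nsq_nonneg
  star_dotProduct_self)
open Literature.MathematicalPhysics.QuantumFieldTheory.Balaban1983to89.B5Action121 (sdiff sdiff_mulVec Fs Fs_apply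
  pd fdiff_mulVec_apply CurlOp form_CurlOp form_curl_eq LapV GradOp GradOp_mulVec form_GradGradH divS
  form_gram_rect nsq_fdiff_mulVec)
open Literature.MathematicalPhysics.QuantumFieldTheory.Balaban1983to89.B5Block118 (QvOp)
open Literature.MathematicalPhysics.QuantumFieldTheory.Balaban1983to89.B5AverageCurlStokes
  (sum_normSq_Fs_le_of_QvOp_eq)
open Literature.MathematicalPhysics.QuantumFieldTheory.Balaban1983to89.B5Bounds167Lattice (d1Sq)
open Literature.MathematicalPhysics.QuantumFieldTheory.Balaban1983to89.Beta.FluctuationProjection (Hk QGQ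
  QvOp_Hk_mulVec)
open Literature.MathematicalPhysics.QuantumFieldTheory.Balaban1983to89.Beta.BlockEffectiveAction (DelK DelK_indep
  curl_energy_Hk curl_energy_min curl_energy_eq DelK_mulVec_grad DelK_conjTranspose QGQ_inv_eq)

/-! ## §1 Two spellings of the unit-lattice plaquette field -/

section Plaquette

variable {d : ℕ} (N : Fin d → ℕ) [hN : ∀ μ, NeZero (N μ)]

/-- pv15's `curl M B μ ν` ((1.66): `∂¹_μB_ν − ∂¹_νB_μ` with `fdiff M 1`) IS B5Action121's plaquette field
`Fs M 1 B μ ν` ((1.2) at `ε = 1`). [folklore] -/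
theorem curl_eq_Fs (B : Tor N × Fin d → ℂ) (μ ν : Fin d) (x : Tor N) :
    B5Bounds167Lattice.curl N B μ ν x = Fs N 1 B μ ν x := by
  unfold B5Bounds167Lattice.curl Fs pd
  rw [fdiff_mulVec_apply, fdiff_mulVec_apply]

/-- `⟨∂₁B, ∂₁B⟩ = ½ Σ_{μ,ν} Σ_y |F¹_{μν}(B)(y)|²`. [cite: Balaban1984PropagatorsI, (1.66)–(1.67) p.29] -/
theorem d1Sq_eq_Fs (B : Tor N × Fin d → ℂ) :
    d1Sq N B = 1 / 2 * ∑ μ, ∑ ν, ∑ x, ‖Fs N 1 B μ ν x‖ ^ 2 := by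
  simp only [d1Sq, curl_eq_Fs]

/-- the plaquette field is additive in the vector field. [folklore] -/
theorem Fs_add (c : ℂ) (A A' : Tor N × Fin d → ℂ) (μ ν : Fin d) (x : Tor N) :
    Fs N c (A + A') μ ν x = Fs N c A μ ν x + Fs N c A' μ ν x := by
  simp only [Fs_apply, Pi.add_apply]
  ring

/-- **`F(∂λ) = 0`**: the plaquette field of a pure gauge vanishes ((1.4): the field strength is gauge invariant).
[cite: Balaban1984PropagatorsI, (1.4) p.18] -/
theorem Fs_grad (c : ℂ) (l : Tor N → ℂ) (μ ν : Fin d) (x : Tor N) :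
    Fs N c (GradOp N c *ᵥ l) μ ν x = 0 := by
  simp only [Fs_apply, GradOp_mulVec, sdiff_mulVec]
  rw [add_right_comm x (unitVec N ν) (unitVec N μ)]
  ring

/-- `(∂₁(∂₁λ))_{μν} = 0` in pv15's spelling. [folklore] -/
theorem curl_grad (l : Tor N → ℂ) (μ ν : Fin d) (x : Tor N) :
    B5Bounds167Lattice.curl N (GradOp N 1 *ᵥ l) μ ν x = 0 := by
  rw [curl_eq_Fs, Fs_grad]

/-- **`⟨∂₁(B + ∂₁λ), ∂₁(B + ∂₁λ)⟩ = ⟨∂₁B, ∂₁B⟩`**: the right-hand side of (1.67) sees only `B mod ∂₁λ`.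
[folklore] -/
theorem d1Sq_add_grad (B : Tor N × Fin d → ℂ) (l : Tor N → ℂ) :
    d1Sq N (B + GradOp N 1 *ᵥ l) = d1Sq N B := by
  simp only [d1Sq_eq_Fs, Fs_add, Fs_grad, add_zero]

/-- `Aᴴ·(Σ_ν ∇_νᴴ∇_ν)·A = Σ_{ν,κ} ‖∂_νA_κ‖²` (a real number): the component-wise Dirichlet energy.
[folklore] -/
theorem LapV_form_eq (c : ℂ) (A : Tor N × Fin d → ℂ) :
    star A ⬝ᵥ (LapV N c *ᵥ A)
      = ((∑ ν, ∑ κ, nsq (sdiff N c ν *ᵥ B5Action121.comp N A κ) : ℝ) : ℂ) := by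
  rw [LapV, Matrix.sum_mulVec, dotProduct_sum]
  push_cast
  refine Finset.sum_congr rfl fun ν _ => ?_
  rw [form_gram_rect, star_dotProduct_self, nsq_fdiff_mulVec]
  push_cast
  rfl

/-- **`½ Σ_{x,μ,ν}|F_{μν}(A)(x)|² ≤ Σ_{ν,κ}‖∂_νA_κ‖²`**: the curl energy is at most the component-wise Dirichlet
energy ((1.21): `½Σ|F|² = ⟨A,(Δ − ∂∂*)A⟩` and `⟨A, ∂∂*A⟩ = ‖∂*A‖² ≥ 0`).
[cite: Balaban1984PropagatorsI, (1.21) p.21] -/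
theorem half_sum_Fs_le_gradEnergy (c : ℂ) (A : Tor N × Fin d → ℂ) :
    1 / 2 * ∑ x, ∑ μ, ∑ ν, ‖Fs N c A μ ν x‖ ^ 2 ≤ ∑ ν, ∑ κ, nsq (sdiff N c ν *ᵥ B5Action121.comp N A κ) := by
  have h := form_curl_eq N c A
  rw [Matrix.sub_mulVec, dotProduct_sub, LapV_form_eq, form_GradGradH, star_dotProduct_self,
    ← Complex.ofReal_sub] at h
  have h' := Complex.ofReal_injective h
  have h0 := nsq_nonneg (divS N c A)
  linarith

end Plaquette

/-! ## §2 The lower half of (1.67) for `DelK`, `γ₀ = 1` -/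

section Main

variable {d : ℕ} (n : ℕ) [NeZero n] (hn : 1 ≤ n) (M : Fin d → ℕ) [hM : ∀ μ, NeZero (M μ)] (a : ℝ)
  (ha : 0 < a)

/-- Federbush's stability [Federbush1986PhaseCellI, (0.12)] summed over the plaquette orientations:
`Σ_{μ,ν,y}|F¹_{μν}(B)(y)|² ≤ n^{-d}·Σ_{x,μ,ν}|F^η_{μν}(A)(x)|²` whenever `Q_kA = B`.
[cite: Federbush1986PhaseCellI, (0.12) p.321 (via `B5AverageCurlStokes`)] -/
theorem sum_normSq_Fs_le (A : Tor (fine n M) × Fin d → ℂ) (B : Tor M × Fin d → ℂ)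
    (hB : QvOp n M *ᵥ A = B) :
    ∑ μ, ∑ ν, ∑ y : Tor M, ‖Fs M 1 B μ ν y‖ ^ 2
      ≤ (1 / (n : ℝ) ^ d) * ∑ x : Tor (fine n M), ∑ μ, ∑ ν, ‖Fs (fine n M) (n : ℂ) A μ ν x‖ ^ 2 := by
  have hx : (∑ x : Tor (fine n M), ∑ μ, ∑ ν, ‖Fs (fine n M) (n : ℂ) A μ ν x‖ ^ 2)
      = ∑ μ, ∑ ν, ∑ x : Tor (fine n M), ‖Fs (fine n M) (n : ℂ) A μ ν x‖ ^ 2 := by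
    rw [Finset.sum_comm]
    exact Finset.sum_congr rfl fun μ _ => Finset.sum_comm
  rw [hx, Finset.mul_sum]
  refine Finset.sum_le_sum fun μ _ => ?_
  rw [Finset.mul_sum]
  exact Finset.sum_le_sum fun ν _ => sum_normSq_Fs_le_of_QvOp_eq n M A B hB μ ν

/-- the curl energy of a fine vector field is the real number `Σ_{x,μ,ν}|F^η_{μν}(A)(x)|²`. [folklore] -/
theorem curl_energy_eq_sum (A : Tor (fine n M) × Fin d → ℂ) :
    star (CurlOp (fine n M) (n : ℂ) *ᵥ A) ⬝ᵥ (CurlOp (fine n M) (n : ℂ) *ᵥ A)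
      = ((∑ x, ∑ μ, ∑ ν, ‖Fs (fine n M) (n : ℂ) A μ ν x‖ ^ 2 : ℝ) : ℂ) := by
  rw [curl_energy_eq, form_CurlOp]

/-- **(1.65) evaluated**: `Bᴴ·Δ_k·B = ½·n^{-d}·Σ_{x,μ,ν}|F^η_{μν}(H_kB)(x)|²` (in particular it is real).
[cite: Balaban1984PropagatorsI, (1.65) p.29] -/
theorem DelK_form_eq (B : Tor M × Fin d → ℂ) :
    star B ⬝ᵥ (DelK n hn M a ha *ᵥ B)
      = ((1 / 2 * (1 / (n : ℝ) ^ d)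
          * ∑ x, ∑ μ, ∑ ν, ‖Fs (fine n M) (n : ℂ) (Hk n hn M a ha *ᵥ B) μ ν x‖ ^ 2 : ℝ) : ℂ) := by
  have hnd : ((n : ℂ) ^ d) ≠ 0 := pow_ne_zero _ (Nat.cast_ne_zero.mpr (NeZero.ne n))
  have h := curl_energy_Hk n hn M a ha B
  rw [curl_energy_eq_sum] at h
  have hF : star B ⬝ᵥ (DelK n hn M a ha *ᵥ B)
      = ((n : ℂ) ^ d)⁻¹ * ((1 / 2 : ℂ) * (((∑ x, ∑ μ, ∑ ν,
          ‖Fs (fine n M) (n : ℂ) (Hk n hn M a ha *ᵥ B) μ ν x‖ ^ 2 : ℝ)) : ℂ)) := by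
    rw [h, ← mul_assoc, inv_mul_cancel₀ hnd, one_mul]
  rw [hF]
  push_cast
  ring

/-- `Re Bᴴ·Δ_k·B = ½·n^{-d}·Σ_{x,μ,ν}|F^η_{μν}(H_kB)(x)|²`. [folklore] -/
theorem DelK_form_re (B : Tor M × Fin d → ℂ) :
    (star B ⬝ᵥ (DelK n hn M a ha *ᵥ B)).re
      = 1 / 2 * (1 / (n : ℝ) ^ d)
          * ∑ x, ∑ μ, ∑ ν, ‖Fs (fine n M) (n : ℂ) (Hk n hn M a ha *ᵥ B) μ ν x‖ ^ 2 := by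
  rw [DelK_form_eq, Complex.ofReal_re]

/-- **THE LOWER HALF OF (1.67) FOR THE GENUINE OPERATOR, `γ₀ = 1`: `⟨∂₁B, ∂₁B⟩ ≤ ⟨B, Δ_kB⟩`** for every
`k` (`n = L^k ≥ 1`), every torus, every `d` — `½Σ|F¹(B)|² = ½Σ|F¹(Q_kH_kB)|² ≤ ½n^{-d}Σ|F^η(H_kB)|² = ⟨B,Δ_kB⟩`.
[cite: Balaban1984PropagatorsI, (1.67) p.29 (lower half; constant ours)] -/
theorem ineq167_lower (B : Tor M × Fin d → ℂ) :
    d1Sq M B ≤ (star B ⬝ᵥ (DelK n hn M a ha *ᵥ B)).re := by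
  rw [DelK_form_re, d1Sq_eq_Fs, mul_assoc]
  refine mul_le_mul_of_nonneg_left ?_ (by norm_num)
  exact sum_normSq_Fs_le n M _ B (QvOp_Hk_mulVec n hn M a ha B)

/-- the same with any `a′` on the left (`Δ_k` is `a`-free): bookkeeping form. [folklore] -/
theorem ineq167_lower' (a' : ℝ) (ha' : 0 < a') (B : Tor M × Fin d → ℂ) :
    d1Sq M B ≤ (star B ⬝ᵥ (DelK n hn M a' ha' *ᵥ B)).re :=
  ineq167_lower n hn M a' ha' B

/-! ## §3 `(Q_kG_kQ_k*)⁻¹ ≥ a + ⟨∂₁·, ∂₁·⟩` -/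

/-- **`a·‖B‖² + ⟨∂₁B, ∂₁B⟩ ≤ Re Bᴴ(Q_kG_kQ_k*)⁻¹B`** (`(QGQ*)⁻¹ = a + Δ_k`), uniformly in `k` and the volume.
Context: [Balaban1984PropagatorsI, (1.100) p.34 (the printed two-sided bound on `QGQ*`)]. [folklore] -/
theorem QGQ_inv_form_ge_d1Sq (B : Tor M × Fin d → ℂ) :
    a * (star B ⬝ᵥ B).re + d1Sq M B ≤ (star B ⬝ᵥ ((QGQ n hn M a ha)⁻¹ *ᵥ B)).re := by
  have h := ineq167_lower n hn M a ha B
  rw [QGQ_inv_eq, Matrix.add_mulVec, Matrix.smul_mulVec, Matrix.one_mulVec, dotProduct_add,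
    dotProduct_smul, smul_eq_mul, Complex.add_re, Complex.re_ofReal_mul]
  linarith

/-! ## §5 Gauge invariance of the left-hand side -/

/-- **`⟨B + ∂₁λ, Δ_k(B + ∂₁λ)⟩ = ⟨B, Δ_kB⟩`** (`Δ_k∂₁ = 0`, `Δ_kᴴ = Δ_k`): with `d1Sq_add_grad`, both sides of
(1.67) are functions of `B mod ∂₁λ`. [folklore] -/
theorem DelK_form_add_grad (B : Tor M × Fin d → ℂ) (l : Tor M → ℂ) :
    star (B + GradOp M 1 *ᵥ l) ⬝ᵥ (DelK n hn M a ha *ᵥ (B + GradOp M 1 *ᵥ l))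
      = star B ⬝ᵥ (DelK n hn M a ha *ᵥ B) := by
  have h1 : DelK n hn M a ha *ᵥ (GradOp M 1 *ᵥ l) = 0 := DelK_mulVec_grad n hn M a ha l
  have h2 : star (GradOp M 1 *ᵥ l) ⬝ᵥ (DelK n hn M a ha *ᵥ B) = 0 := by
    rw [B5Action121.dotProduct_mulVec_eq_star_conjTranspose_mulVec, DelK_conjTranspose, h1, star_zero,
      zero_dotProduct]
  rw [Matrix.mulVec_add, h1, add_zero, star_add, add_dotProduct, h2, add_zero]

/-! ## §6 The door for the upper half: `⟨B, Δ_kB⟩ ≤` the Dirichlet energy of ANY right inverse -/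

/-- `Re⟨B, Δ_kB⟩ ≤ ½·n^{-d}·Σ|F^η(A)|²` for EVERY fine `A` with `Q_kA = B` (`H_kB` minimizes the curl energy,
`curl_energy_min`). [cite: Balaban1984PropagatorsI, p.29 before (1.64) (the minimum property)] -/
theorem DelK_form_le_of_QvOp_eq (A : Tor (fine n M) × Fin d → ℂ) (B : Tor M × Fin d → ℂ)
    (hA : QvOp n M *ᵥ A = B) :
    (star B ⬝ᵥ (DelK n hn M a ha *ᵥ B)).re
      ≤ (1 / (n : ℝ) ^ d) * (1 / 2 * ∑ x, ∑ μ, ∑ ν, ‖Fs (fine n M) (n : ℂ) A μ ν x‖ ^ 2) := by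
  have hmin := curl_energy_min n hn M a ha A B hA
  rw [curl_energy_eq_sum, curl_energy_eq_sum, Complex.ofReal_re, Complex.ofReal_re] at hmin
  rw [DelK_form_re]
  have hpos : (0 : ℝ) ≤ 1 / (n : ℝ) ^ d := by positivity
  calc 1 / 2 * (1 / (n : ℝ) ^ d)
          * ∑ x, ∑ μ, ∑ ν, ‖Fs (fine n M) (n : ℂ) (Hk n hn M a ha *ᵥ B) μ ν x‖ ^ 2
        = (1 / (n : ℝ) ^ d)
          * (1 / 2 * ∑ x, ∑ μ, ∑ ν, ‖Fs (fine n M) (n : ℂ) (Hk n hn M a ha *ᵥ B) μ ν x‖ ^ 2) := by ring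
    _ ≤ (1 / (n : ℝ) ^ d) * (1 / 2 * ∑ x, ∑ μ, ∑ ν, ‖Fs (fine n M) (n : ℂ) A μ ν x‖ ^ 2) :=
        mul_le_mul_of_nonneg_left (mul_le_mul_of_nonneg_left hmin (by norm_num)) hpos

/-- **THE DOOR: `Re⟨B, Δ_kB⟩ ≤ n^{-d}·Σ_{ν,κ}‖∂^η_νA_κ‖²` for every fine `A` with `Q_kA = B`** — the upper half
of (1.67) with constant `γ₁` follows from any right inverse of `Q_k` whose component-wise `η`-lattice Dirichlet
energy is at most `γ₁·n^d·⟨∂₁B, ∂₁B⟩` (on transverse `B`, cf. §5).  NOT walked through in this file.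
[folklore] -/
theorem DelK_form_le_gradEnergy (A : Tor (fine n M) × Fin d → ℂ) (B : Tor M × Fin d → ℂ)
    (hA : QvOp n M *ᵥ A = B) :
    (star B ⬝ᵥ (DelK n hn M a ha *ᵥ B)).re
      ≤ (1 / (n : ℝ) ^ d) * ∑ ν, ∑ κ, nsq (sdiff (fine n M) (n : ℂ) ν *ᵥ B5Action121.comp (fine n M) A κ) :=
  (DelK_form_le_of_QvOp_eq n hn M a ha A B hA).trans
    (mul_le_mul_of_nonneg_left (half_sum_Fs_le_gradEnergy (fine n M) (n : ℂ) A) (by positivity))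

end Main

/-! ## §4 The `B5.FormData` carrier of the genuine operator and the B6 (2.118) edge -/

section Carrier

variable {d : ℕ}

/-- the (1.64)–(1.67) form data of the unit torus `T₁ = Π_μ ℤ/M_μ` at step `k` (`n = L^k ≥ 1`) with `formΔk` THE
GENUINE `Re⟨B, Δ_kB⟩` of (1.65) (`Beta.BlockEffectiveAction.DelK`; `a > 0` is a dummy, `DelK_indep`) and
`d1Sq = ⟨∂₁B, ∂₁B⟩` (pv15's).  Compare `B5Bounds167Lattice.formOfLattice`, whose `formΔk` is the (1.66)-DEFINED
`formDk`. [cite: Balaban1984PropagatorsI, (1.64)–(1.67) p.29 (packaging ours)] -/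
def formOfDelK (n : ℕ) (hn : 1 ≤ n) (M : Fin d → ℕ) [∀ μ, NeZero (M μ)] (a : ℝ) (ha : 0 < a) : B5.FormData :=
  haveI : NeZero n := ⟨by omega⟩
  { Cfg := Tor M × Fin d → ℂ
    formΔk := fun B => (star B ⬝ᵥ (DelK n hn M a ha *ᵥ B)).re
    d1Sq := d1Sq M }

/-- the carrier does not depend on the dummy `a`. [folklore] -/
theorem formOfDelK_indep (n : ℕ) (hn : 1 ≤ n) (M : Fin d → ℕ) [∀ μ, NeZero (M μ)] (a : ℝ) (ha : 0 < a)
    (a' : ℝ) (ha' : 0 < a') : formOfDelK n hn M a ha = formOfDelK n hn M a' ha' := by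
  haveI : NeZero n := ⟨by omega⟩
  unfold formOfDelK
  rw [DelK_indep n hn M a ha a' ha']

/-- **THE B6 (2.118) EDGE FOR THE OPERATOR CARRIERS**: for every family of steps `n i ≥ 1`, tori `M i` and dummies
`a i > 0`, `∃ γ₀ > 0, ∀ i B, γ₀·⟨∂₁B,∂₁B⟩ ≤ Re⟨B, Δ_kB⟩` (with `γ₀ = 1`) — literally the conclusion of
`B6.h2118_of_B5`, i.e. the (2.118) input «⟨B, Δ_kB⟩ ≥ γ₀⟨∂₁B, ∂₁B⟩» of B6's lower bound (2.153), here for the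
GENUINE operator of (1.65) rather than for the (1.66)-defined form.
[cite: Balaban1984PropagatorsI, (1.67) p.29; Balaban1984PropagatorsII, (2.118) p.243 (context)] -/
theorem h2118_formOfDelK {I : Type} (n : I → ℕ) (hn : ∀ i, 1 ≤ n i) (M : I → Fin d → ℕ)
    [hM : ∀ i μ, NeZero (M i μ)] (a : I → ℝ) (ha : ∀ i, 0 < a i) :
    ∃ γ₀ : ℝ, 0 < γ₀ ∧ ∀ i (B : (formOfDelK (n i) (hn i) (M i) (a i) (ha i)).Cfg),
      γ₀ * (formOfDelK (n i) (hn i) (M i) (a i) (ha i)).d1Sq B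
        ≤ (formOfDelK (n i) (hn i) (M i) (a i) (ha i)).formΔk B := by
  refine ⟨1, one_pos, fun i B => ?_⟩
  haveI : NeZero (n i) := ⟨by have := hn i; omega⟩
  rw [one_mul]
  exact ineq167_lower (n i) (hn i) (M i) (a i) (ha i) B

/-- the LOWER conjunct of `B5.Bounds167` in its literal shape, `γ₀ = 1`, for the operator carriers (the upper
conjunct is NOT claimed). [cite: Balaban1984PropagatorsI, (1.67) p.29 (lower half)] -/
theorem lower167_formOfDelK {I : Type} (n : I → ℕ) (hn : ∀ i, 1 ≤ n i) (M : I → Fin d → ℕ)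
    [hM : ∀ i μ, NeZero (M i μ)] (a : I → ℝ) (ha : ∀ i, 0 < a i) (i : I)
    (B : (formOfDelK (n i) (hn i) (M i) (a i) (ha i)).Cfg) :
    1 * (formOfDelK (n i) (hn i) (M i) (a i) (ha i)).d1Sq B
      ≤ (formOfDelK (n i) (hn i) (M i) (a i) (ha i)).formΔk B := by
  haveI : NeZero (n i) := ⟨by have := hn i; omega⟩
  rw [one_mul]
  exact ineq167_lower (n i) (hn i) (M i) (a i) (ha i) B

end Carrier

end Literature.MathematicalPhysics.QuantumFieldTheory.Balaban1983to89.Beta.Ineq167Operator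

end
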